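import Mathlib
import Summits.NavierStokesRegularity.NavierStokesRegularity.Theorems.TaoLadderRungTwoBreakOneShiftCentre
import Summits.NavierStokesRegularity.NavierStokesRegularity.Theorems.TaoLadderRungThreeGappedFrontRobustComparison
import Literature.Analysis.FluidPDE.Tao2016AveragedNS.ShiftSetCascadeFlux
import HarnessLib

/-!
# The one-shift window system, I: the WINDOW FIELD and its Lipschitz / size / continuity estimates
# (cell harvest/h2-tao-ladder, seat p2; towards the `Φ`-part of the window certificate `OneShiftWindowCert`
# of module …OneShiftMapDefs, rung1/RUNG1-P2G9-REPORT.md §37/§40; support for K1(1) = `NoSurvivingDSSOne`,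
# stmt-NavierStokesRegularity-20205)

MODEL lattice ODEs only (Tao 2016 §4 normal form on Tao's shift set `S`); nothing here is a statement about
the Navier–Stokes equations; no item is closed.

The window certificate posits a window-run map `Φ`: for every admissible datum (window start state `y` in
the box, continuous tail trajectories `T` in the tubes) a solution of the FINITE window system
`Ṡ_{i,k} = quadTerm_{i,k}(S)`, `0 ≤ k < W`, with the wake shell `-1` and the top shell `W` read off `T` as
continuous edge inputs, on the whole flight `[0, τ_hi]`. This module sets up that system as an ODE on
`ℝ^{m×W}` with the hypotheses of Picard–Lindelöf / continuation:

* `OneShiftFrame.WState` (sup norm), `encode`, `assemble` (window state + tails ↦ lattice family), `wfield`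
  (the window field at time `t`), `familyOf` (window trajectory + tails ↦ full family), `quadTerm_familyOf`;
* `abs_wfield_sub_le`, `abs_wfield_le`, `lipschitzOnWith_wfield`, `norm_wfield_le`, `continuousOn_wfield`:
  Lipschitz and bounded on every ball uniformly in `t ∈ [0, τ_hi]`, continuous in `t` (constants
  `tableSum α`, `gainW = (1+ε₀)^{5W/2}`, `ampBound ρ = ρ + 2B(wt(-1) + wt(W))`).

Existence on the flight (continuation from an a priori bound, the energy bound, the `WindowRun` packaging)
is in the sequel modules …OneShiftWindowExist / …OneShiftWindowEnergy.
-/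

noncomputable section

-- the sub-problem namespace repeats the summit name by design (D-0017)
set_option linter.dupNamespace false

namespace Summit.NavierStokesRegularity.NavierStokesRegularity.Theorems

namespace DSSOneShift

open Set Metric Filter Topology Literature.Analysis.FluidPDE Literature.Analysis.FluidPDE.TaoCascade
  CertificateGlueOn
open scoped NNReal

variable {m : ℕ}

namespace OneShiftFrame

variable (F : OneShiftFrame m)

/-! ### The window state space and the assembled family -/

/-- The window state space `ℝ^{m × W}` with the sup norm. [cite: Tao2016AveragedNS, §4 (4.7); cell vocabulary, harvest/h2-tao-ladder rung1/KERNEL-STAGE3-PLAN.md §1] -/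
abbrev WState : Type := Fin m → Fin F.W → ℝ

/-- The `Fin W` index of a window shell. [folklore] -/
def widx {k : ℤ} (h : F.InWindow k) : Fin F.W :=
  ⟨k.toNat, by have h1 := h.1; have h2 := h.2; omega⟩

/-- The index of the shell `(j : ℤ)` is `j`. [folklore] -/
theorem widx_natCast (j : Fin F.W) (h : F.InWindow ((j : ℕ) : ℤ)) : F.widx h = j := by
  ext; simp [widx]

/-- `((widx h : ℕ) : ℤ) = k`. [folklore] -/
theorem natCast_widx {k : ℤ} (h : F.InWindow k) : ((F.widx h : ℕ) : ℤ) = k := by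
  have h1 := h.1
  simp [widx, Int.toNat_of_nonneg h1]

/-- Every `j : Fin W` is a window shell. [folklore] -/
theorem inWindow_natCast (j : Fin F.W) : F.InWindow ((j : ℕ) : ℤ) :=
  ⟨by positivity, by exact_mod_cast j.2⟩

/-- Encode a lattice state on the window as a window state. [folklore] -/
def encode (y : Fin m → ℤ → ℝ) : F.WState := fun i j => y i ((j : ℕ) : ℤ)

/-- **The assembled family**: window shells from the window state `x` (frozen in time), every other
shell from the tails `T`. [cite: Tao2016AveragedNS, §4 (4.7)–(4.8); cell vocabulary, harvest/h2-tao-ladder rung1/KERNEL-STAGE3-PLAN.md §1] -/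
def assemble (x : F.WState) (T : Fin m → ℤ → ℝ → ℝ) : Fin m → ℤ → ℝ → ℝ := fun i k s =>
  if h : F.InWindow k then x i (F.widx h) else T i k s

/-- **The window field** at time `t` with tails `T`: the quadratic term (4.8) of the assembled family on the
window shells (the wake shell `-1` and the top shell `W` enter as the inputs `T_{·,-1}(t)`, `T_{·,W}(t)`).
[cite: Tao2016AveragedNS, §4 Lemma 4.1 (4.8); cell vocabulary, window-truncated with edge inputs] -/
def wfield (ε₀ : ℝ) (α : Fin m → Fin m → Fin m → ℤ × ℤ × ℤ → ℝ) (T : Fin m → ℤ → ℝ → ℝ) (t : ℝ)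
    (x : F.WState) : F.WState :=
  fun i j => quadTerm ε₀ α (F.assemble x T) i ((j : ℕ) : ℤ) t

/-- **The full family of a window trajectory** `β` and tails `T`. [cite: Tao2016AveragedNS, §4 (4.7); cell vocabulary, harvest/h2-tao-ladder rung1/KERNEL-STAGE3-PLAN.md §1] -/
def familyOf (β : ℝ → F.WState) (T : Fin m → ℤ → ℝ → ℝ) : Fin m → ℤ → ℝ → ℝ := fun i k s =>
  if h : F.InWindow k then β s i (F.widx h) else T i k s

/-- Off the window the full family is the tail. [folklore] -/
theorem familyOf_of_not {β : ℝ → F.WState} {T : Fin m → ℤ → ℝ → ℝ} (i : Fin m) {k : ℤ}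
    (hk : ¬ F.InWindow k) : F.familyOf β T i k = T i k := by
  funext s; simp [familyOf, hk]

/-- On the window the full family is the trajectory coordinate. [folklore] -/
theorem familyOf_of_mem {β : ℝ → F.WState} {T : Fin m → ℤ → ℝ → ℝ} (i : Fin m) {k : ℤ}
    (hk : F.InWindow k) : F.familyOf β T i k = fun s => β s i (F.widx hk) := by
  funext s; simp only [familyOf, dif_pos hk]

/-- At a fixed time the full family is the assembled family of the current window state. [folklore] -/
theorem familyOf_apply_eq_assemble (β : ℝ → F.WState) (T : Fin m → ℤ → ℝ → ℝ) (i : Fin m) (k : ℤ)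
    (t : ℝ) : F.familyOf β T i k t = F.assemble (β t) T i k t := by
  simp [familyOf, assemble]

/-- The quadratic term at time `t` only depends on the values of the family at time `t`.
[cite: Tao2016AveragedNS, §4 (4.8)] -/
theorem quadTerm_congr_at {ε₀ : ℝ} {α : Fin m → Fin m → Fin m → ℤ × ℤ × ℤ → ℝ}
    {X Y : Fin m → ℤ → ℝ → ℝ} {t : ℝ} (h : ∀ i k, X i k t = Y i k t) (i : Fin m) (n : ℤ) :
    quadTerm ε₀ α X i n t = quadTerm ε₀ α Y i n t := by
  unfold quadTerm
  simp only [h]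

/-- Along a window trajectory the quadratic term of the full family is the window field.
[cite: Tao2016AveragedNS, §4 (4.8); cell vocabulary, window-truncated with edge inputs] -/
theorem quadTerm_familyOf {ε₀ : ℝ} {α : Fin m → Fin m → Fin m → ℤ × ℤ × ℤ → ℝ} (β : ℝ → F.WState)
    (T : Fin m → ℤ → ℝ → ℝ) (i : Fin m) (j : Fin F.W) (t : ℝ) :
    quadTerm ε₀ α (F.familyOf β T) i ((j : ℕ) : ℤ) t = F.wfield ε₀ α T t (β t) i j := by
  unfold wfield
  exact quadTerm_congr_at (fun i' k => F.familyOf_apply_eq_assemble β T i' k t) i _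

/-! ### Constants -/

/-- The total size of the table, `∑_{i} ∑_{i₁,i₂} ∑_{μ ∈ S} |α_{i₁ i₂ i μ}|`. [cite: Tao2016AveragedNS, §4 (4.1) (the structure constants)] -/
def tableSum (α : Fin m → Fin m → Fin m → ℤ × ℤ × ℤ → ℝ) : ℝ :=
  ∑ i, ∑ i₁, ∑ i₂, ∑ μ ∈ shiftSet, |α i₁ i₂ i μ|

/-- `tableSum ≥ 0`. [folklore] -/
theorem tableSum_nonneg (α : Fin m → Fin m → Fin m → ℤ × ℤ × ℤ → ℝ) : 0 ≤ tableSum α := by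
  unfold tableSum; positivity

/-- One receiving mode is bounded by the total. [folklore] -/
theorem rowSum_le_tableSum (α : Fin m → Fin m → Fin m → ℤ × ℤ × ℤ → ℝ) (i : Fin m) :
    ∑ i₁, ∑ i₂, ∑ μ ∈ shiftSet, |α i₁ i₂ i μ| ≤ tableSum α := by
  unfold tableSum
  exact Finset.single_le_sum (f := fun i => ∑ i₁, ∑ i₂, ∑ μ ∈ shiftSet, |α i₁ i₂ i μ|)
    (fun _ _ => by positivity) (Finset.mem_univ i)

/-- The largest gain on the window, `(1+ε₀)^{5W/2}`. [cite: Tao2016AveragedNS, §4 (4.8) (the clock (1+ε₀)^{5n/2})] -/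
def gainW (ε₀ : ℝ) : ℝ := (1 + ε₀) ^ ((5 : ℝ) * F.W / 2)

/-- `gainW > 0` for `ε₀ ≥ 0`. [folklore] -/
theorem gainW_pos {ε₀ : ℝ} (hε : 0 ≤ ε₀) : 0 < F.gainW ε₀ := by
  unfold gainW; exact Real.rpow_pos_of_pos (by linarith) _

/-- A window gain is at most `gainW`. [folklore] -/
theorem gain_le_gainW {ε₀ : ℝ} (hε : 0 ≤ ε₀) (j : Fin F.W) :
    (1 + ε₀) ^ ((5 : ℝ) * (((j : ℕ) : ℤ) : ℝ) / 2) ≤ F.gainW ε₀ := by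
  unfold gainW
  refine Real.rpow_le_rpow_of_exponent_le (by linarith) ?_
  have : (((j : ℕ) : ℤ) : ℝ) ≤ F.W := by exact_mod_cast j.2.le
  linarith

/-- The amplitude bound of the assembled family on the shells `-1 … W` when the window state has norm
`≤ ρ`: `ρ + 2B(wt(-1) + wt(W))`. [cite: Tao2016AveragedNS, §4 (4.5); cell vocabulary, harvest/h2-tao-ladder rung1/STAGE3-BANACH.md §1] -/
def ampBound (ρ : ℝ) : ℝ := ρ + 2 * F.B * (F.wt (-1) + F.wt F.W)

/-- `ρ ≤ ampBound ρ`. [folklore] -/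
theorem le_ampBound (ρ : ℝ) : ρ ≤ F.ampBound ρ := by
  unfold ampBound
  have := F.B_nonneg; have := F.wt_pos (-1); have := F.wt_pos F.W
  nlinarith

/-- `ampBound ρ ≥ 0` for `ρ ≥ 0`. [folklore] -/
theorem ampBound_nonneg {ρ : ℝ} (hρ : 0 ≤ ρ) : 0 ≤ F.ampBound ρ := hρ.trans (F.le_ampBound ρ)

/-! ### Size and Lipschitz estimates of the window field -/

/-- Tails in their tubes at time `t`: the per-shell bound `2B · wt k`. [cite: Tao2016AveragedNS, §4 (4.5); cell vocabulary, harvest/h2-tao-ladder rung1/STAGE3-BANACH.md §1] -/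
theorem abs_tail_le {T : Fin m → ℤ → ℝ → ℝ} {t : ℝ} {i : Fin m} {k : ℤ}
    (hT : |T i k t - F.tubeC i k| ≤ F.tubeR k) : |T i k t| ≤ 2 * F.B * F.wt k := by
  have h1 := F.tubeR_le k
  have h2 := F.tubeC_le i k
  have h3 : |T i k t| ≤ |T i k t - F.tubeC i k| + |F.tubeC i k| := by
    have := abs_add_le (T i k t - F.tubeC i k) (F.tubeC i k); simpa using this
  linarith

/-- A non-window shell among `n-1, n, n+1` for a window shell `n` is one of the two edge shells. [folklore] -/
theorem edge_of_not_inWindow (j : Fin F.W) {k : ℤ} (hk : ¬ F.InWindow k)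
    (h1 : ((j : ℕ) : ℤ) - 1 ≤ k) (h2 : k ≤ ((j : ℕ) : ℤ) + 1) : k = -1 ∨ k = F.W := by
  have hj := j.2
  unfold InWindow at hk
  omega

/-- **Bilinear difference bound for the window field** (`ε₀ ≥ 0`): for window states of norm `≤ ρ` and tails
in their tubes at time `t`,
`|wfield(x)_{i,j} − wfield(x')_{i,j}| ≤ 2 · tableSum · gainW · ampBound ρ · ‖x − x'‖`.
[cite: Tao2016AveragedNS, §4 (4.8) (the bilinear term)] -/
theorem abs_wfield_sub_le {ε₀ : ℝ} (hε : 0 ≤ ε₀) (α : Fin m → Fin m → Fin m → ℤ × ℤ × ℤ → ℝ)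
    {T : Fin m → ℤ → ℝ → ℝ} {t : ℝ} (hT : ∀ i k, ¬ F.InWindow k → |T i k t - F.tubeC i k| ≤ F.tubeR k)
    {ρ : ℝ} (hρ : 0 ≤ ρ) {x x' : F.WState} (hx : ‖x‖ ≤ ρ) (hx' : ‖x'‖ ≤ ρ) (i : Fin m) (j : Fin F.W) :
    |F.wfield ε₀ α T t x i j - F.wfield ε₀ α T t x' i j| ≤
      2 * tableSum α * F.gainW ε₀ * F.ampBound ρ * ‖x - x'‖ := by
  have hB := F.B_nonneg
  have hw1 := F.wt_pos (-1)
  have hwW := F.wt_pos F.W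
  -- amplitude / difference envelopes
  set A : ℤ → ℝ := fun k => if F.InWindow k then ρ else 2 * F.B * F.wt k with hA
  set D : ℤ → ℝ := fun k => if F.InWindow k then ‖x - x'‖ else 0 with hD
  have hAX : ∀ (x₁ : F.WState), ‖x₁‖ ≤ ρ → ∀ i' k, |F.assemble x₁ T i' k t| ≤ A k := by
    intro x₁ hx₁ i' k
    simp only [hA, assemble]
    split_ifs with h
    · exact ((Real.norm_eq_abs _).symm.le.trans ((norm_le_pi_norm (x₁ i') _).trans
        ((norm_le_pi_norm x₁ i').trans hx₁)))
    · exact F.abs_tail_le (hT i' k h)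
  have hDX : ∀ i' k, |F.assemble x T i' k t - F.assemble x' T i' k t| ≤ D k := by
    intro i' k
    simp only [hD, assemble]
    split_ifs with h
    · have e : x i' (F.widx h) - x' i' (F.widx h) = (x - x') i' (F.widx h) := rfl
      rw [e]
      exact (Real.norm_eq_abs _).symm.le.trans ((norm_le_pi_norm ((x - x') i') _).trans
        (norm_le_pi_norm (x - x') i'))
    · simp
  have hA3 : ∀ k, ((j : ℕ) : ℤ) - 1 ≤ k → k ≤ ((j : ℕ) : ℤ) + 1 → A k ≤ F.ampBound ρ := by
    intro k h1 h2
    simp only [hA]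
    split_ifs with h
    · exact F.le_ampBound ρ
    · rcases F.edge_of_not_inWindow j h h1 h2 with rfl | rfl
      · unfold ampBound; nlinarith
      · unfold ampBound; nlinarith
  have hD3 : ∀ k, ((j : ℕ) : ℤ) - 1 ≤ k → k ≤ ((j : ℕ) : ℤ) + 1 → D k ≤ ‖x - x'‖ := by
    intro k _ _
    simp only [hD]
    split_ifs
    · exact le_rfl
    · exact norm_nonneg _
  have h := GappedFrontRobust.abs_quadTerm_sub_quadTerm_le_of_le ε₀ hε α (F.assemble x T)
    (F.assemble x' T) i ((j : ℕ) : ℤ) t (hAX x hx) (hAX x' hx') hDX hA3 hD3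
  unfold wfield
  refine h.trans ?_
  have hg := F.gain_le_gainW hε j
  have hg0 : 0 ≤ (1 + ε₀) ^ ((5 : ℝ) * (((j : ℕ) : ℤ) : ℝ) / 2) := Real.rpow_nonneg (by linarith) _
  have hr := rowSum_le_tableSum α i
  have hr0 : 0 ≤ ∑ i₁, ∑ i₂, ∑ μ ∈ shiftSet, |α i₁ i₂ i μ| := by positivity
  have ha := F.ampBound_nonneg hρ
  have hn := norm_nonneg (x - x')
  have : (∑ i₁, ∑ i₂, ∑ μ ∈ shiftSet, |α i₁ i₂ i μ|) * (1 + ε₀) ^ ((5 : ℝ) * (((j : ℕ) : ℤ) : ℝ) / 2) ≤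
      tableSum α * F.gainW ε₀ := mul_le_mul hr hg hg0 (tableSum_nonneg α)
  nlinarith [mul_nonneg ha hn]

/-- **Size of the window field** (`ε₀ ≥ 0`): `|wfield(x)_{i,j}| ≤ 2 · tableSum · gainW · (ampBound ρ)²` for
`‖x‖ ≤ ρ` and tails in their tubes. [cite: Tao2016AveragedNS, §4 (4.8)] -/
theorem abs_wfield_le {ε₀ : ℝ} (hε : 0 ≤ ε₀) (α : Fin m → Fin m → Fin m → ℤ × ℤ × ℤ → ℝ)
    {T : Fin m → ℤ → ℝ → ℝ} {t : ℝ} (hT : ∀ i k, ¬ F.InWindow k → |T i k t - F.tubeC i k| ≤ F.tubeR k)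
    {ρ : ℝ} (hρ : 0 ≤ ρ) {x : F.WState} (hx : ‖x‖ ≤ ρ) (i : Fin m) (j : Fin F.W) :
    |F.wfield ε₀ α T t x i j| ≤ 2 * tableSum α * F.gainW ε₀ * F.ampBound ρ * F.ampBound ρ := by
  have hB := F.B_nonneg
  have hw1 := F.wt_pos (-1)
  have hwW := F.wt_pos F.W
  set A : ℤ → ℝ := fun k => if F.InWindow k then ρ else 2 * F.B * F.wt k with hA
  have hA0 : ∀ k, 0 ≤ A k := fun k => by
    simp only [hA]; split_ifs
    · exact hρ
    · have := F.wt_pos k; positivity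
  have hAX : ∀ i' k, |F.assemble x T i' k t| ≤ A k := by
    intro i' k
    simp only [hA, assemble]
    split_ifs with h
    · exact ((Real.norm_eq_abs _).symm.le.trans ((norm_le_pi_norm (x i') _).trans
        ((norm_le_pi_norm x i').trans hx)))
    · exact F.abs_tail_le (hT i' k h)
  have hAY : ∀ (i' : Fin m) (k : ℤ), |(fun (_ : Fin m) (_ : ℤ) (_ : ℝ) => (0 : ℝ)) i' k t| ≤ A k :=
    fun i' k => by simpa using hA0 k
  have hDX : ∀ i' k, |F.assemble x T i' k t - (fun (_ : Fin m) (_ : ℤ) (_ : ℝ) => (0 : ℝ)) i' k t| ≤ A k :=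
    fun i' k => by simpa using hAX i' k
  have hA3 : ∀ k, ((j : ℕ) : ℤ) - 1 ≤ k → k ≤ ((j : ℕ) : ℤ) + 1 → A k ≤ F.ampBound ρ := by
    intro k h1 h2
    simp only [hA]
    split_ifs with h
    · exact F.le_ampBound ρ
    · rcases F.edge_of_not_inWindow j h h1 h2 with rfl | rfl
      · unfold ampBound; nlinarith
      · unfold ampBound; nlinarith
  have h := GappedFrontRobust.abs_quadTerm_sub_quadTerm_le_of_le ε₀ hε α (F.assemble x T)
    (fun _ _ _ => (0 : ℝ)) i ((j : ℕ) : ℤ) t hAX hAY hDX hA3 hA3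
  have hz : quadTerm ε₀ α (fun (_ : Fin m) (_ : ℤ) (_ : ℝ) => (0 : ℝ)) i ((j : ℕ) : ℤ) t = 0 := by
    simp [quadTerm]
  rw [hz, sub_zero] at h
  unfold wfield
  refine h.trans ?_
  have hg := F.gain_le_gainW hε j
  have hg0 : 0 ≤ (1 + ε₀) ^ ((5 : ℝ) * (((j : ℕ) : ℤ) : ℝ) / 2) := Real.rpow_nonneg (by linarith) _
  have hr := rowSum_le_tableSum α i
  have hr0 : 0 ≤ ∑ i₁, ∑ i₂, ∑ μ ∈ shiftSet, |α i₁ i₂ i μ| := by positivity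
  have ha := F.ampBound_nonneg hρ
  have : (∑ i₁, ∑ i₂, ∑ μ ∈ shiftSet, |α i₁ i₂ i μ|) * (1 + ε₀) ^ ((5 : ℝ) * (((j : ℕ) : ℤ) : ℝ) / 2) ≤
      tableSum α * F.gainW ε₀ := mul_le_mul hr hg hg0 (tableSum_nonneg α)
  nlinarith [mul_nonneg ha ha]

/-- The Lipschitz constant of the window field on the ball of radius `ρ`. [cite: Tao2016AveragedNS, §4 (4.8)] -/
def lipConst (ε₀ : ℝ) (α : Fin m → Fin m → Fin m → ℤ × ℤ × ℤ → ℝ) (ρ : ℝ) : ℝ≥0 :=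
  Real.toNNReal (2 * tableSum α * F.gainW ε₀ * F.ampBound ρ)

/-- The sup bound of the window field on the ball of radius `ρ`. [cite: Tao2016AveragedNS, §4 (4.8)] -/
def supConst (ε₀ : ℝ) (α : Fin m → Fin m → Fin m → ℤ × ℤ × ℤ → ℝ) (ρ : ℝ) : ℝ≥0 :=
  Real.toNNReal (2 * tableSum α * F.gainW ε₀ * F.ampBound ρ * F.ampBound ρ)

/-- **The window field is Lipschitz on every ball**, uniformly in time on the flight.
[cite: Tao2016AveragedNS, §4 (4.8); Teschl2012, Thm 2.2 (hypotheses of Picard–Lindelöf)] -/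
theorem lipschitzOnWith_wfield {ε₀ : ℝ} (hε : 0 ≤ ε₀) (α : Fin m → Fin m → Fin m → ℤ × ℤ × ℤ → ℝ)
    {T : Fin m → ℤ → ℝ → ℝ} {t : ℝ} (hT : ∀ i k, ¬ F.InWindow k → |T i k t - F.tubeC i k| ≤ F.tubeR k)
    {ρ : ℝ} (hρ : 0 ≤ ρ) :
    LipschitzOnWith (F.lipConst ε₀ α ρ) (F.wfield ε₀ α T t) (closedBall 0 ρ) := by
  refine LipschitzOnWith.of_dist_le_mul fun x hx x' hx' => ?_
  rw [mem_closedBall_zero_iff] at hx hx'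
  have h0 : 0 ≤ 2 * tableSum α * F.gainW ε₀ * F.ampBound ρ := by
    have := tableSum_nonneg α; have := (F.gainW_pos hε).le; have := F.ampBound_nonneg hρ
    positivity
  have hK : ((F.lipConst ε₀ α ρ : ℝ≥0) : ℝ) = 2 * tableSum α * F.gainW ε₀ * F.ampBound ρ := by
    unfold lipConst; exact Real.coe_toNNReal _ h0
  rw [hK]
  have hd : 0 ≤ 2 * tableSum α * F.gainW ε₀ * F.ampBound ρ * dist x x' := mul_nonneg h0 dist_nonneg
  refine (dist_pi_le_iff hd).2 fun i => (dist_pi_le_iff hd).2 fun j => ?_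
  rw [Real.dist_eq, dist_eq_norm]
  exact F.abs_wfield_sub_le hε α hT hρ hx hx' i j

/-- **The window field is bounded on every ball**, uniformly in time on the flight.
[cite: Tao2016AveragedNS, §4 (4.8); Teschl2012, Thm 2.2] -/
theorem norm_wfield_le {ε₀ : ℝ} (hε : 0 ≤ ε₀) (α : Fin m → Fin m → Fin m → ℤ × ℤ × ℤ → ℝ)
    {T : Fin m → ℤ → ℝ → ℝ} {t : ℝ} (hT : ∀ i k, ¬ F.InWindow k → |T i k t - F.tubeC i k| ≤ F.tubeR k)
    {ρ : ℝ} (hρ : 0 ≤ ρ) {x : F.WState} (hx : x ∈ closedBall (0 : F.WState) ρ) :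
    ‖F.wfield ε₀ α T t x‖ ≤ F.supConst ε₀ α ρ := by
  rw [mem_closedBall_zero_iff] at hx
  have h0 : 0 ≤ 2 * tableSum α * F.gainW ε₀ * F.ampBound ρ * F.ampBound ρ := by
    have := tableSum_nonneg α; have := (F.gainW_pos hε).le; have := F.ampBound_nonneg hρ
    positivity
  have hL : ((F.supConst ε₀ α ρ : ℝ≥0) : ℝ) = 2 * tableSum α * F.gainW ε₀ * F.ampBound ρ * F.ampBound ρ := by
    unfold supConst; exact Real.coe_toNNReal _ h0
  rw [hL]
  refine (pi_norm_le_iff_of_nonneg h0).2 fun i => (pi_norm_le_iff_of_nonneg h0).2 fun j => ?_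
  rw [Real.norm_eq_abs]
  exact F.abs_wfield_le hε α hT hρ hx i j

/-- **The window field is continuous in time** on the flight for fixed state, when the tails are
continuous there. [cite: Tao2016AveragedNS, §4 (4.8); Teschl2012, Thm 2.2] -/
theorem continuousOn_wfield (ε₀ : ℝ) (α : Fin m → Fin m → Fin m → ℤ × ℤ × ℤ → ℝ)
    {T : Fin m → ℤ → ℝ → ℝ} (hT : ∀ i k, ¬ F.InWindow k → ContinuousOn (T i k) (Icc 0 F.τhi))
    (x : F.WState) : ContinuousOn (fun t => F.wfield ε₀ α T t x) (Icc 0 F.τhi) := by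
  refine continuousOn_pi.2 fun i => continuousOn_pi.2 fun j => ?_
  have hS : ∀ i' k, ContinuousOn (F.assemble x T i' k) (Icc 0 F.τhi) := by
    intro i' k
    by_cases h : F.InWindow k
    · have : F.assemble x T i' k = fun _ => x i' (F.widx h) := by
        funext s; simp only [assemble, dif_pos h]
      rw [this]; exact continuousOn_const
    · have : F.assemble x T i' k = T i' k := by funext s; simp only [assemble, dif_neg h]
      rw [this]; exact hT i' k h
  simpa [wfield, quadTermOn_shiftSet] using
    continuousOn_quadTermOn shiftSet ε₀ α hS i ((j : ℕ) : ℤ)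

end OneShiftFrame

end DSSOneShift

end Summit.NavierStokesRegularity.NavierStokesRegularity.Theorems
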